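import Mathlib.NumberTheory.LegendreSymbol.JacobiSymbol
import Literature.NumberTheory.Sieve.BatemanHorn
import Literature.NumberTheory.Sieve.ParityBatemanHorn
import Literature.NumberTheory.Sieve.ParityWave0
import Literature.NumberTheory.Sieve.SingularSeries
import Literature.NumberTheory.Sieve.AletheiaZomleferFukshanskyGarcia2020
import Literature.NumberTheory.LFunctions.LogIntegral
import HarnessLib
import HarnessLib.Audit

/-!
# Aletheia-Zomlefer–Fukshansky–Garcia (2020): consequences of the Bateman–Horn conjecture

Topic `Literature/NumberTheory/Sieve` (family `parity`, sub-problem `BatemanHorn`). Vendored from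
S. L. Aletheia-Zomlefer, L. Fukshansky, S. R. Garcia, *The Bateman–Horn conjecture: heuristics,
history, and applications*, Expo. Math. 38 (2020) 430–479 = arXiv:1807.08899 (bib key
`AletheiaZomleferFukshanskyGarcia2020`; all locators — sections, `Theorem 6.4.1`, displays
`(6.5.1)`, … — are those of arXiv v4 (5 Apr 2019), which numbers results and displays by
subsection; plain-text renderings that renumber results consecutively are not used), §3.6
(Brun-sieve upper bound), §6 (single polynomials) and §7 (several polynomials). The statement of
the conjecture and the convergence of its constant (§3–§5) are vendored separately in
`Literature/NumberTheory/Sieve/AletheiaZomleferFukshanskyGarcia2020.lean` (imported here for the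
positivity lemma `HasBatemanHornConst.pos_of_ne_zero` of its §5.1).

Throughout, `Q(f₁,…,f_k; x) = Literature.polyPrimeCount f x`, `ω_f(p) = Literature.polyRootCountMod f p`,
`C(f₁,…,f_k)` is the ordered limit `Literature.HasBatemanHornConst f C`, `C₂ = Literature.twinPrimeConst`,
`π₂ = Literature.twinPrimeCount`, and `BatemanHornConjecture` is the tree's `x/(log x)^k` form of the
conjecture (`Literature/NumberTheory/Sieve/ParityBatemanHorn.lean`).

## Contents

* §3.6 — the Brun-sieve upper bound `Q ≤ B · C(f)/(∏ deg fᵢ) · ∫₂ˣ dt/(log t)^k`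
  (NAMED FACT `polyPrimeCount_le_brunSieve`).
* §6.1 — `ω_f(p)` and `C(f) = a/φ(a)` for `f = at + b` (PROVED: `polyRootCountMod_linear`,
  `batemanHornPartial_linear`, `hasBatemanHornConst_linear`), and Bateman–Horn ⇒ prime number
  theorem for arithmetic progressions (Theorem 6.1.1, (6.1.2); NAMED FACT
  `primeCountingMod_isEquivalent_of_batemanHorn`).
* §6.2 — Bateman–Horn ⇒ Landau's conjecture (NAMED FACT `landauConjecture_of_batemanHorn`,
  DISCHARGED: `landauConjecture_of_batemanHorn_holds`, via `x² + 1` being a Bateman–Horn system,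
  `isBatemanHornSystem_X_sq_add_one`, and `Q(x²+1; x) ≥ 1` forcing `C(x²+1) > 0`).
* §6.4 Theorem 6.4.1 — a polynomial that is prime at every `n ≥ 0` is constant (PROVED,
  `eq_C_of_forall_prime_eval`).
* §6.5 — Hardy–Littlewood's Conjecture F, display (6.5.1) (`HardyLittlewoodConjF`, a `Prop`
  def), the values `ω_f(2)` (6.5.2) (PROVED) and `ω_f(p) = 1 + (Δ/p)` (NAMED FACT) for
  `f = at² + bt + c`, Bateman–Horn ⇒
  Conjecture F (NAMED FACT `hardyLittlewoodConjF_of_batemanHorn`), and the PROVED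
  specialisation `HardyLittlewoodConjF.conjE : Conjecture F → Conjecture E` (`n² + 1`; a
  faithfulness check against the tree's `HardyLittlewoodConjE`).
* §7.1 — twin primes: `ω(p)` for `t(t + 2)` (PROVED), `C(t, t+2) = 2C₂` (PROVED given the
  tree's convergence fact `tendsto_twinPrimeConstPartial`), Bateman–Horn ⇒
  `π₂(x) ∼ 2C₂ x/(log x)²` (PROVED, `twinPrimeCount_isEquivalent_of_batemanHorn`) and hence ⇒
  the twin prime conjecture (PROVED given also `twinPrimeConst_pos`,
  `twinPrimeConjecture_of_batemanHorn`).
* §7.2 — prime pairs `p, p + k`: `primePairCount` (= the tree's `primeTupleCount {0,k}`,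
  PROVED, discharging the tree's fact `twinPrimeCount_eq_primeTupleCount`), the constants `C_k`
  of (7.2.2) (`primePairConst`), `C_{2^m} = C₂` (PROVED), `C(t, t+k) = 2C_k` (7.2.1) and Bateman–Horn ⇒
  `π_k(x) ∼ 2C_k x/(log x)²` (NAMED FACTS).
* §7.3 — Sophie Germain primes: `ω`, `C(t, 2t+1) = 2C₂`, Bateman–Horn ⇒ their asymptotic count
  and infinitude (PROVED, given the tree's twin-prime-constant facts).
* §7.4 — Cunningham chains: `cunninghamTerm`, `IsCunninghamChain`; a chain of the first kind
  starting at an odd prime `q` has fewer than `q` terms (PROVED,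
  `IsCunninghamChain.length_lt`); Bateman–Horn ⇒ infinitely many chains of every length
  (NAMED FACT).
* §7.5 Theorem 7.5.1 — Bateman–Horn ⇒ Green–Tao (NAMED FACT `greenTao_of_batemanHorn`).

## Design choices

* Ordered partial products over `Nat.primesLE x` throughout (D-SIEVE-1), as in the tree's
  `BatemanHorn.lean`; the source's `∫₂ˣ dt/(log t)^k` is `offsetLogIntegralPow k x`, and where
  the source immediately passes to `x/(log x)^k` by its Lemma 2.3.2 we state that form.
* Conjecture F: the source's sentence "the number of such primes at most `x`" is, by its own
  derivation ((3.6.2) with `deg f = 2` and (6.5.3): `C(f) = 2ε ∏ ∏`), the count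
  `Q(f; x)` of `t ≤ x` with `f(t)` prime; we vendor that derived form (with `x/log x` for
  `Li(x)`), which for `f = t² + 1` is literally the tree's `HardyLittlewoodConjE`
  (`HardyLittlewoodConjF.conjE`). Legendre symbols `(Δ/p)` are Mathlib's `jacobiSym Δ p`
  (equal to the Legendre symbol at odd primes, and defined without a primality instance).
* Implications "Bateman–Horn ⇒ X" are `def … : Prop := BatemanHornConjecture → X` named facts
  (as the tree's `hardyLittlewoodConjE_of_batemanHorn`), except where a short proof is
  available.
-/

noncomputable section

open Filter Finset Polynomial Asymptotics
open scoped Topology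

namespace Literature.NumberTheory.Sieve

/-! ### §3.6 — the Brun-sieve upper bound -/

/-- **§3.6** (the display after (3.6.3); the source cites Tenenbaum's book): "an upper bound
similar to (3.6.2) is known to be true" — the Brun sieve gives a constant `B` depending only on
`k` and the degrees such that, under the Bateman–Horn hypotheses,
`Q(f₁,…,f_k; x) ≤ B · C(f₁,…,f_k)/(∏ deg fᵢ) · ∫₂ˣ dt/(log t)^k` for all sufficiently large `x`.
[cite: AletheiaZomleferFukshanskyGarcia2020, §3.6 (display after (3.6.3), Brun sieve)] -/
def polyPrimeCount_le_brunSieve : Prop :=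
  ∀ (k : ℕ) (d : Fin k → ℕ), ∃ B : ℝ, ∀ f : Fin k → ℤ[X], IsBatemanHornSystem f →
    (∀ i, (f i).natDegree = d i) → ∀ C : ℝ, HasBatemanHornConst f C →
      ∀ᶠ x : ℕ in atTop,
        (polyPrimeCount f x : ℝ) ≤ B * C / (∏ i, (d i : ℝ)) * LFunctions.offsetLogIntegralPow k x

/-! ### §6.1 — primes in arithmetic progressions -/

/-- **§6.1**: for `f(t) = at + b` with `a, b` relatively prime natural numbers and a prime `p`,
`ω_f(p) = 1` if `p ∤ a` and `ω_f(p) = 0` if `p ∣ a` (the display after (6.1.4): `at ≡ -b` has a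
unique solution mod `p ∤ a`, none mod `p ∣ a` as `gcd(a, b) = 1`). PROVED.
[cite: AletheiaZomleferFukshanskyGarcia2020, §6.1 (display for ω_f after (6.1.4))] -/
theorem polyRootCountMod_linear (a b : ℕ) (hab : a.Coprime b) {p : ℕ} (hp : p.Prime) :
    polyRootCountMod ![C (a : ℤ) * X + C (b : ℤ)] p = if p ∣ a then 0 else 1 := by
  haveI := Fact.mk hp
  unfold polyRootCountMod
  simp only [Fin.prod_univ_one, Matrix.cons_val_fin_one, eval_add, eval_mul, eval_C, eval_X]
  have hcast : ∀ n : ℕ, ((p : ℤ) ∣ (a : ℤ) * (n : ℤ) + (b : ℤ)) ↔ ((a : ZMod p) * n + b = 0) := by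
    intro n
    rw [← ZMod.intCast_zmod_eq_zero_iff_dvd]
    push_cast
    rfl
  simp_rw [hcast]
  split_ifs with hpa
  · rw [card_eq_zero, filter_eq_empty_iff]
    intro n _ h0
    rw [(ZMod.natCast_eq_zero_iff a p).mpr hpa, zero_mul, zero_add, ZMod.natCast_eq_zero_iff]
      at h0
    exact hp.one_lt.ne' ((Nat.Coprime.coprime_dvd_left hpa hab).eq_one_of_dvd h0)
  · have ha0 : (a : ZMod p) ≠ 0 := by rwa [Ne, ZMod.natCast_eq_zero_iff]
    set r : ZMod p := -(b : ZMod p) / a with hr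
    have hset : (range p).filter (fun n : ℕ ↦ (a : ZMod p) * n + b = 0) = {r.val} := by
      ext n
      simp only [mem_filter, mem_range, mem_singleton]
      constructor
      · rintro ⟨hn, h0⟩
        have : (n : ZMod p) = r := by
          rw [hr, eq_div_iff ha0]
          linear_combination h0
        rw [← this, ZMod.val_natCast, Nat.mod_eq_of_lt hn]
      · rintro rfl
        refine ⟨ZMod.val_lt r, ?_⟩
        rw [ZMod.natCast_zmod_val, hr]
        field_simp
        ring
    rw [hset, card_singleton]

/-- `∏_{p ∣ a} (1 - 1/p)⁻¹ = a/φ(a)` (Euler's product (6.1.3) for `φ`, via Mathlib's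
`Nat.totient_mul_prod_primeFactors`). [cite: AletheiaZomleferFukshanskyGarcia2020, §6.1 (6.1.3)] -/
theorem prod_primeFactors_inv_eq_div_totient {a : ℕ} (ha : 0 < a) :
    ∏ p ∈ a.primeFactors, (1 - 1 / (p : ℝ))⁻¹ = (a : ℝ) / Nat.totient a := by
  have hφ : (0 : ℝ) < Nat.totient a := by exact_mod_cast Nat.totient_pos.mpr ha
  have hcast : ((∏ p ∈ a.primeFactors, (p - 1) : ℕ) : ℝ) = ∏ p ∈ a.primeFactors, ((p : ℝ) - 1) := by
    rw [Nat.cast_prod]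
    refine prod_congr rfl fun p hp ↦ ?_
    rw [Nat.cast_sub (Nat.prime_of_mem_primeFactors hp).one_le, Nat.cast_one]
  have key : (Nat.totient a : ℝ) * ∏ p ∈ a.primeFactors, (p : ℝ) =
      a * ∏ p ∈ a.primeFactors, ((p : ℝ) - 1) := by
    rw [← hcast]
    have := congrArg (Nat.cast : ℕ → ℝ) (Nat.totient_mul_prod_primeFactors a)
    push_cast at this ⊢
    convert this using 2
  have hp1 : ∀ p ∈ a.primeFactors, (p : ℝ) - 1 ≠ 0 := fun p hp ↦ by
    have : (1 : ℝ) < p := by exact_mod_cast (Nat.prime_of_mem_primeFactors hp).one_lt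
    linarith
  have hp0 : ∀ p ∈ a.primeFactors, (p : ℝ) ≠ 0 := fun p hp ↦ by
    exact_mod_cast (Nat.prime_of_mem_primeFactors hp).ne_zero
  have hprod : ∏ p ∈ a.primeFactors, (1 - 1 / (p : ℝ))⁻¹ =
      (∏ p ∈ a.primeFactors, (p : ℝ)) / ∏ p ∈ a.primeFactors, ((p : ℝ) - 1) := by
    rw [← prod_div_distrib]
    refine prod_congr rfl fun p hp ↦ ?_
    field_simp [hp0 p hp, hp1 p hp]
  rw [eq_div_iff hφ.ne', hprod, div_mul_eq_mul_div, div_eq_iff (prod_ne_zero_iff.mpr hp1),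
    mul_comm, key]

/-- **§6.1**: for `f(t) = at + b` with `a, b` relatively prime natural numbers, `a ≥ 1`, the
Bateman–Horn partial products are eventually the finite product
`∏_{p ∣ a} (1 - 1/p)⁻¹ = a/φ(a)` ("the potentially infinite product reduces to a finite product
indexed only over the prime divisors of `a`"). PROVED.
[cite: AletheiaZomleferFukshanskyGarcia2020, §6.1 (display for C(f;p), via (6.1.3))] -/
theorem batemanHornPartial_linear (a b : ℕ) (ha : 0 < a) (hab : a.Coprime b) {x : ℕ}
    (hx : a ≤ x) : batemanHornPartial ![C (a : ℤ) * X + C (b : ℤ)] x = (a : ℝ) / Nat.totient a := by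
  rw [← prod_primeFactors_inv_eq_div_totient ha]
  unfold batemanHornPartial
  rw [Fintype.card_fin]
  have h1 : ∀ p ∈ Nat.primesLE x, (1 - 1 / (p : ℝ))⁻¹ ^ 1 *
      (1 - (polyRootCountMod ![C (a : ℤ) * X + C (b : ℤ)] p : ℝ) / p) =
      if p ∣ a then (1 - 1 / (p : ℝ))⁻¹ else 1 := by
    intro p hp
    have hpp := (Nat.mem_primesLE.mp hp).2
    rw [polyRootCountMod_linear a b hab hpp, pow_one]
    split_ifs with h
    · simp
    · have hp0 : (0 : ℝ) < p := by exact_mod_cast hpp.pos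
      have : (1 : ℝ) - 1 / p ≠ 0 := by
        rw [sub_ne_zero, ne_comm, ne_eq, div_eq_one_iff_eq hp0.ne']
        have : (1 : ℝ) < p := by exact_mod_cast hpp.one_lt
        linarith
      push_cast
      rw [inv_mul_cancel₀ this]
  rw [prod_congr rfl h1, prod_ite, prod_const_one, mul_one]
  refine prod_congr ?_ fun _ _ ↦ rfl
  ext p
  simp only [mem_filter, Nat.mem_primesLE, Nat.mem_primeFactors, ne_eq]
  constructor
  · rintro ⟨⟨-, hp⟩, hpa⟩
    exact ⟨hp, hpa, ha.ne'⟩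
  · rintro ⟨hp, hpa, -⟩
    exact ⟨⟨(Nat.le_of_dvd ha hpa).trans hx, hp⟩, hpa⟩

/-- **§6.1**: hence `C(f) = ∏_{p ∣ a} (1 - 1/p)⁻¹ = a/φ(a)` for `f(t) = at + b`, `gcd(a, b) = 1`,
`a ≥ 1` (as an ordered limit: the partial products are eventually constant). PROVED.
[cite: AletheiaZomleferFukshanskyGarcia2020, §6.1 (display for C(f;p))] -/
theorem hasBatemanHornConst_linear (a b : ℕ) (ha : 0 < a) (hab : a.Coprime b) :
    HasBatemanHornConst ![C (a : ℤ) * X + C (b : ℤ)] ((a : ℝ) / Nat.totient a) := by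
  unfold HasBatemanHornConst
  refine tendsto_const_nhds.congr' ?_
  filter_upwards [eventually_ge_atTop a] with x hx
  exact (batemanHornPartial_linear a b ha hab hx).symm

/-- **§6.1, Theorem 6.1.1 / (6.1.2) from Bateman–Horn**: the conjecture implies the prime number
theorem for arithmetic progressions, `π_{a,b}(x) ∼ Li(x)/φ(a)` for `gcd(a, b) = 1` (here with the
tree's residue-class count `Literature.Parity.primeCountingMod a b x = #{p ≤ x prime : p ≡ b (mod a)}`,
which differs from the source's `#{p ≤ x : p = at + b, t ≥ 1}` by `O(1)`).
[cite: AletheiaZomleferFukshanskyGarcia2020, §6.1 Theorem 6.1.1 (6.1.2), derived from Bateman–Horn] -/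
def primeCountingMod_isEquivalent_of_batemanHorn : Prop :=
  BatemanHornConjecture → ∀ (a b : ℕ), 0 < a → b.Coprime a →
    (fun x : ℕ ↦ (ParityWave0.primeCountingMod a b x : ℝ)) ~[atTop]
      fun x : ℕ ↦ LFunctions.offsetLogIntegral x / Nat.totient a

/-! ### §6.2 — Landau's conjecture -/

/-- **§6.2** (and §3.3–§3.4): Bateman–Horn for `f = t² + 1` (`C(f) ≈ 1.3728`,
`Q(f; x) ∼ (C(f)/2) Li(x)`) implies Landau's conjecture that `n² + 1` is prime infinitely
often (the tree's `Literature.NumberTheory.Sieve.LandauConjecture`).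
[cite: AletheiaZomleferFukshanskyGarcia2020, §6.2] -/
def landauConjecture_of_batemanHorn : Prop :=
  BatemanHornConjecture → Sieve.LandauConjecture

/-- `x² + 1` is irreducible in `ℤ[x]` (§3.3 of the source: "let `f(x) = x² + 1`. Then `f` is
irreducible"): it is monic with no rational root. [folklore] -/
theorem irreducible_X_sq_add_one_int : Irreducible (X ^ 2 + 1 : ℤ[X]) := by
  have hmonic : (X ^ 2 + 1 : ℤ[X]).Monic := monic_X_pow_add_C 1 two_ne_zero
  rw [hmonic.irreducible_iff_irreducible_map_fraction_map (K := ℚ)]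
  have hmap : (X ^ 2 + 1 : ℤ[X]).map (algebraMap ℤ ℚ) = X ^ 2 + 1 := by simp
  rw [hmap]
  have hdeg : (X ^ 2 + 1 : ℚ[X]).natDegree = 2 := by
    simpa using natDegree_X_pow_add_C (n := 2) (r := (1 : ℚ))
  refine (irreducible_iff_roots_eq_zero_of_degree_le_three (by omega) (by omega)).mpr ?_
  refine Multiset.eq_zero_of_forall_notMem fun r hr ↦ ?_
  have hne : (X ^ 2 + 1 : ℚ[X]) ≠ 0 := (monic_X_pow_add_C 1 two_ne_zero).ne_zero
  rw [mem_roots hne, IsRoot, eval_add, eval_pow, eval_X, eval_one] at hr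
  nlinarith [sq_nonneg r]

/-- `ω_{x²+1}(p) ≤ 2` for every prime `p` (§3.3: "`ω(p)`, the number of solutions to
`x² + 1 ≡ 0 (mod p)`", at most `deg f = 2` in the field `ℤ/pℤ`). [folklore] -/
theorem polyRootCountMod_X_sq_add_one_le_two (p : ℕ) [Fact p.Prime] :
    polyRootCountMod ![(X ^ 2 + 1 : ℤ[X])] p ≤ 2 := by
  unfold polyRootCountMod
  simp only [Fin.prod_univ_one, Matrix.cons_val_fin_one, eval_add, eval_pow, eval_X, eval_one]
  set q : (ZMod p)[X] := X ^ 2 + 1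
  have hq0 : q ≠ 0 := (monic_X_pow_add_C 1 two_ne_zero).ne_zero
  have hdeg : q.natDegree = 2 := by
    simpa [q] using natDegree_X_pow_add_C (n := 2) (r := (1 : ZMod p))
  calc #((range p).filter fun n : ℕ ↦ (p : ℤ) ∣ (n : ℤ) ^ 2 + 1)
      ≤ #q.roots.toFinset := by
        refine card_le_card_of_injOn (fun n : ℕ ↦ (n : ZMod p)) ?_ ?_
        · intro n hn
          simp only [coe_filter, Set.mem_setOf_eq, mem_range] at hn
          rw [mem_coe, Multiset.mem_toFinset, mem_roots hq0, IsRoot, eval_add, eval_pow, eval_X,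
            eval_one]
          have := (ZMod.intCast_zmod_eq_zero_iff_dvd _ p).mpr hn.2
          push_cast at this
          exact this
        · intro a ha b hb hab
          simp only [coe_filter, Set.mem_setOf_eq, mem_range] at ha hb
          have := congrArg ZMod.val hab
          rwa [ZMod.val_natCast_of_lt ha.1, ZMod.val_natCast_of_lt hb.1] at this
    _ ≤ Multiset.card q.roots := Multiset.toFinset_card_le _
    _ ≤ q.natDegree := card_roots' q
    _ = 2 := hdeg

/-- **§3.3–§3.4, §6.2**: the single polynomial `f(x) = x² + 1` satisfies the hypotheses of the
Bateman–Horn conjecture — irreducible, positive leading coefficient, and `f` does not vanish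
identically modulo any prime (`ω(2) = 1`, `ω(p) ≤ 2 < p` for `p ≥ 3`).
[cite: AletheiaZomleferFukshanskyGarcia2020, §3.3–§3.4 (single polynomial `x² + 1`)] -/
theorem isBatemanHornSystem_X_sq_add_one : IsBatemanHornSystem ![(X ^ 2 + 1 : ℤ[X])] where
  irreducible i := by
    fin_cases i
    exact irreducible_X_sq_add_one_int
  leadingCoeff_pos i := by
    fin_cases i
    have hmonic : (X ^ 2 + 1 : ℤ[X]).Monic := monic_X_pow_add_C 1 two_ne_zero
    show 0 < (X ^ 2 + 1 : ℤ[X]).leadingCoeff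
    rw [hmonic.leadingCoeff]
    exact one_pos
  pairwise_not_associated := Subsingleton.pairwise
  hasNoFixedPrimeDivisor p hp := by
    by_cases h2 : p = 2
    · subst h2
      rw [polyRootCountMod_X_sq_add_one_two]
      norm_num
    · haveI := Fact.mk hp
      have h3 : 3 ≤ p := by have := hp.two_le; omega
      exact (polyRootCountMod_X_sq_add_one_le_two p).trans_lt h3

/-- `x / log x → ∞` along `ℕ`. [folklore] -/
theorem tendsto_natCast_div_log_atTop :
    Tendsto (fun x : ℕ ↦ (x : ℝ) / Real.log x) atTop atTop := by
  have h2 : Tendsto (fun x : ℝ ↦ Real.log x ^ (1 : ℝ) / x ^ (1 : ℝ)) atTop (𝓝 0) :=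
    (isLittleO_log_rpow_rpow_atTop 1 one_pos).tendsto_div_nhds_zero
  have h3 : Tendsto (fun x : ℝ ↦ Real.log x / x) atTop (𝓝[>] 0) := by
    refine tendsto_nhdsWithin_iff.mpr ⟨?_, ?_⟩
    · refine h2.congr' ?_
      filter_upwards [eventually_gt_atTop 0] with x hx
      rw [Real.rpow_one, Real.rpow_one]
    · filter_upwards [eventually_gt_atTop 1] with x hx
      exact div_pos (Real.log_pos hx) (by linarith)
  refine ((h3.inv_tendsto_nhdsGT_zero).comp tendsto_natCast_atTop_atTop).congr fun x ↦ ?_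
  simp [inv_div]

/-- `Q(x² + 1; x) ≥ 1` for `x ≥ 1` (`1² + 1 = 2` is prime). [folklore] -/
theorem one_le_nSqAddOnePrimeCount {x : ℕ} (hx : 1 ≤ x) : 1 ≤ nSqAddOnePrimeCount x := by
  unfold nSqAddOnePrimeCount
  refine Finset.one_le_card.mpr ⟨1, ?_⟩
  simp only [mem_filter, mem_Icc, le_refl, hx, and_self, true_and]
  decide

/-- **§6.2 discharged**: Bateman–Horn ⇒ Landau's conjecture. From the conjecture for the system
`![x² + 1]` (`isBatemanHornSystem_X_sq_add_one`) we get `Q(x²+1; x) ∼ (C/2) x/log x` with `C` the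
ordered limit of the partial products; `C ≠ 0` because otherwise `Q` would vanish eventually
(but `Q ≥ 1`), hence `C > 0` (`HasBatemanHornConst.pos_of_ne_zero`, §5.1), so `Q → ∞` and
`{n : n² + 1 prime}` is infinite. (The source's route is via Theorem 5.4.3, `C(f) ≈ 1.3728 > 0`;
the argument here avoids the convergence theorem.)
[cite: AletheiaZomleferFukshanskyGarcia2020, §6.2] -/
theorem landauConjecture_of_batemanHorn_holds : landauConjecture_of_batemanHorn := by
  intro hBH
  have hsys := isBatemanHornSystem_X_sq_add_one
  obtain ⟨C, hC, hQ⟩ := hBH 1 _ hsys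
  have hQ' : (fun x : ℕ ↦ (nSqAddOnePrimeCount x : ℝ)) ~[atTop]
      fun x : ℕ ↦ C / 2 * (x : ℝ) / Real.log x := by
    convert hQ using 2 with x x
    · rw [polyPrimeCount_X_sq_add_one]
    · have hdeg : (X ^ 2 + 1 : ℤ[X]).natDegree = 2 := by
        simpa using natDegree_X_pow_add_C (n := 2) (r := (1 : ℤ))
      simp [hdeg]
  have hC0 : C ≠ 0 := by
    rintro rfl
    have h0 : (fun x : ℕ ↦ (nSqAddOnePrimeCount x : ℝ)) ~[atTop] (0 : ℕ → ℝ) :=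
      hQ'.congr_right (Eventually.of_forall fun x ↦ by simp)
    rw [isEquivalent_zero_iff_eventually_zero] at h0
    obtain ⟨x, hx0, hx1⟩ := (h0.and (eventually_ge_atTop 1)).exists
    have := one_le_nSqAddOnePrimeCount hx1
    have h' : (nSqAddOnePrimeCount x : ℝ) = 0 := hx0
    rw [Nat.cast_eq_zero] at h'
    omega
  have hCpos : 0 < C := hC.pos_of_ne_zero hsys.hasNoFixedPrimeDivisor hC0
  have hlim : Tendsto (fun x : ℕ ↦ (nSqAddOnePrimeCount x : ℝ)) atTop atTop := by
    refine hQ'.symm.tendsto_atTop ?_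
    have := tendsto_natCast_div_log_atTop.const_mul_atTop (show 0 < C / 2 by positivity)
    simpa [mul_div_assoc] using this
  refine Set.infinite_of_forall_exists_gt fun n ↦ ?_
  by_contra hcon
  push Not at hcon
  have hbound : ∀ x, (nSqAddOnePrimeCount x : ℝ) ≤ (n + 1 : ℕ) := by
    intro x
    unfold nSqAddOnePrimeCount
    exact_mod_cast (card_le_card (fun m hm ↦ by
      simp only [mem_filter, mem_Icc, mem_range] at hm ⊢
      have := hcon m hm.2
      omega)).trans (card_range (n + 1)).le
  obtain ⟨x, hx⟩ := (hlim.eventually (eventually_gt_atTop ((n + 1 : ℕ) : ℝ))).exists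
  exact absurd hx (not_lt.mpr (hbound x))

/-! ### §6.4 — prime-generating polynomials -/

/-- **Theorem 6.4.1** of the source: if `f ∈ ℤ[x]` and `f(n)` is prime for all `n ≥ 0`, then `f`
is constant (indeed `f = p`, `p = f(0)`). Proof as printed: `p = f(0)` divides `f(pn)`, so
`f(pn) = p` for all `n` and `f - p` has infinitely many roots.
[cite: AletheiaZomleferFukshanskyGarcia2020, §6.4 Theorem 6.4.1] -/
theorem eq_C_of_forall_prime_eval (f : ℤ[X])
    (h : ∀ n : ℕ, ∃ p : ℕ, p.Prime ∧ f.eval (n : ℤ) = p) : ∃ p : ℕ, p.Prime ∧ f = C (p : ℤ) := by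
  obtain ⟨p, hp, h0⟩ := h 0
  refine ⟨p, hp, ?_⟩
  have key : ∀ n : ℕ, f.eval ((p : ℤ) * n) = p := by
    intro n
    obtain ⟨q, hq, hqn⟩ := h (p * n)
    push_cast at hqn
    have hdvd : (p : ℤ) ∣ f.eval ((p : ℤ) * n) - f.eval 0 :=
      (dvd_mul_right (p : ℤ) n).trans (by simpa using sub_dvd_eval_sub ((p : ℤ) * n) 0 f)
    rw [Nat.cast_zero] at h0
    rw [h0, hqn] at hdvd
    have hpq : (p : ℤ) ∣ q := by simpa using dvd_add hdvd (dvd_refl (p : ℤ))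
    have := (Nat.prime_dvd_prime_iff_eq hp hq).mp (by exact_mod_cast hpq)
    rw [hqn, this]
  have hroots : Set.Infinite {x : ℤ | (f - C (p : ℤ)).IsRoot x} := by
    refine Set.infinite_of_injective_forall_mem (f := fun n : ℕ ↦ (p : ℤ) * n) ?_ ?_
    · intro m n hmn
      have hp0 : (p : ℤ) ≠ 0 := by exact_mod_cast hp.ne_zero
      exact_mod_cast mul_left_cancel₀ hp0 hmn
    · intro n
      simp [key n]
  exact sub_eq_zero.mp (eq_zero_of_infinite_isRoot _ hroots)

/-! ### §6.5 — Hardy–Littlewood's Conjecture F -/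

/-- **§6.5, display (6.5.2)**: for `f(t) = at² + bt + c` with `a + b` and `c` not both even,
`ω_f(2) = 0` if `a + b` is even (and `c` odd) and `ω_f(2) = 1` if `a + b` is odd (`f(0) = c`,
`f(1) = a + b + c`). PROVED. [cite: AletheiaZomleferFukshanskyGarcia2020, §6.5 (6.5.2)] -/
theorem polyRootCountMod_quadratic_two (a b c : ℤ) (h : ¬(Even (a + b) ∧ Even c)) :
    polyRootCountMod ![C a * X ^ 2 + C b * X + C c] 2 = if Even (a + b) then 0 else 1 := by
  unfold polyRootCountMod
  simp only [Fin.prod_univ_one, Matrix.cons_val_fin_one, eval_add, eval_mul, eval_C, eval_pow,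
    eval_X]
  rw [show range 2 = {0, 1} by decide, filter_insert, filter_singleton]
  simp only [Nat.cast_zero, Nat.cast_one, Nat.cast_ofNat, mul_zero, zero_pow two_ne_zero, zero_add,
    one_pow, mul_one]
  have e1 : (2 : ℤ) ∣ c ↔ Even c := even_iff_two_dvd.symm
  have e2 : (2 : ℤ) ∣ a + b + c ↔ (Even (a + b) ↔ Even c) := by
    rw [← even_iff_two_dvd, Int.even_add]
  simp only [e1, e2]
  by_cases hab : Even (a + b) <;> by_cases hc : Even c
  · exact absurd ⟨hab, hc⟩ h
  · simp [hab, hc]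
  · simp [hab, hc]
  · simp [hab, hc]

/-- **§6.5, the two displays between (6.5.2) and (6.5.3)**: for `f(t) = at² + bt + c` with `gcd(a, b, c) = 1` and an odd
prime `p`: if `p ∣ a` then `ω_f(p) = 0` or `1` according as `p ∣ b` or not; if `p ∤ a` then
`ω_f(p) = 1 + (Δ/p)` with `Δ = b² - 4ac` (completing the square), `(Δ/p)` the Legendre symbol
(Mathlib's `jacobiSym Δ p`). [cite: AletheiaZomleferFukshanskyGarcia2020, §6.5 (displays for ω_f(p), p odd, before (6.5.3))] -/
def polyRootCountMod_quadratic_odd : Prop :=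
  ∀ a b c : ℤ, 0 < a → Int.gcd (Int.gcd a b) c = 1 → ∀ p : ℕ, p.Prime → 2 < p →
    (polyRootCountMod ![C a * X ^ 2 + C b * X + C c] p : ℤ) =
      if (p : ℤ) ∣ a then (if (p : ℤ) ∣ b then 0 else 1) else 1 + jacobiSym (b ^ 2 - 4 * a * c) p

/-- **Hardy–Littlewood's Conjecture F** in the formulation of §6.5, display (6.5.1), of the source (after
Jacobson–Williams 2003; Hardy–Littlewood 1923, Conjecture F). If `a, b, c` are relatively prime
integers, `a > 0`, `a + b` and `c` are not both even, and `Δ = b² - 4ac` is not a perfect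
square, then there are infinitely many primes of the form `at² + bt + c` (`t ∈ ℕ`, the same
count as below), and `Q(f; x) = #{t ≤ x : at² + bt + c prime} ∼ ε · ∏_{p ≥ 3, p ∣ gcd(a,b)} p/(p-1) ·
∏_{p ≥ 3, p ∤ a} (1 - (Δ/p)/(p-1)) · x/log x`, with `ε = 1/2` if `a + b` is odd and `ε = 1`
otherwise, the second (conditionally convergent) product being an ordered limit `S`.
The source writes the main term with `Li(x)` (`∼ x/log x`, its Lemma 2.3.2) and calls `Q(f; x)`
"the number of such primes at most `x`"; its derivation ((3.6.2) with `deg f = 2` and (6.5.3),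
`C(f) = 2ε ∏ ∏`) shows the count meant is `Q(f; x)`. For `f = t² + 1` this is the tree's
`HardyLittlewoodConjE` (`HardyLittlewoodConjF.conjE`). Open.
[cite: AletheiaZomleferFukshanskyGarcia2020, §6.5 Hardy–Littlewood Conjecture (F) (6.5.1) and (6.5.3)] -/
@[conjecture] def HardyLittlewoodConjF : Prop :=
  ∀ a b c : ℤ, 0 < a → Int.gcd (Int.gcd a b) c = 1 → ¬(Even (a + b) ∧ Even c) →
    ¬IsSquare (b ^ 2 - 4 * a * c) →
    {p : ℕ | p.Prime ∧ ∃ t : ℕ, (p : ℤ) = a * t ^ 2 + b * t + c}.Infinite ∧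
    ∃ S : ℝ,
      Tendsto (fun x : ℕ ↦ ∏ p ∈ (Nat.primesLE x).filter (fun p : ℕ ↦ 2 < p ∧ ¬((p : ℤ) ∣ a)),
        (1 - (jacobiSym (b ^ 2 - 4 * a * c) p : ℝ) / ((p : ℝ) - 1))) atTop (𝓝 S) ∧
      (fun x : ℕ ↦ (polyPrimeCount ![C a * X ^ 2 + C b * X + C c] x : ℝ)) ~[atTop]
        fun x : ℕ ↦ (if Even (a + b) then 1 else 2⁻¹ : ℝ) *
          (∏ p ∈ (Int.gcd a b).primeFactors.filter (2 < ·), (p : ℝ) / ((p : ℝ) - 1)) *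
            S * x / Real.log x

/-- **§6.5**: Conjecture F "is a consequence of the Bateman–Horn conjecture" (with
`C(f) = 2ε ∏_{p≥3, p ∣ gcd(a,b)} p/(p-1) ∏_{p≥3, p∤a} (1 - (Δ/p)/(p-1))` and `deg f = 2`).
[cite: AletheiaZomleferFukshanskyGarcia2020, §6.5 ((6.5.1) from (3.6.1)–(3.6.3) via (6.5.3))] -/
def hardyLittlewoodConjF_of_batemanHorn : Prop :=
  BatemanHornConjecture → HardyLittlewoodConjF

/-- `(-4/n) = χ₋₄(n)` for odd `n` (Jacobi symbols; first supplement to quadratic reciprocity,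
Mathlib's `jacobiSym.at_neg_one`), the link between the `Δ = -4` case of Conjecture F and the
tree's Conjecture E constant. [folklore] -/
theorem jacobiSym_neg_four {n : ℕ} (hn : Odd n) : jacobiSym (-4) n = ZMod.χ₄ n := by
  have hgcd : (2 : ℤ).gcd n = 1 := by
    rw [show (2 : ℤ) = ((2 : ℕ) : ℤ) from rfl, Int.gcd_natCast_natCast]
    exact Nat.coprime_two_left.mpr hn
  rw [show (-4 : ℤ) = -1 * 2 ^ 2 by norm_num, jacobiSym.mul_left, jacobiSym.sq_one' hgcd,
    mul_one, jacobiSym.at_neg_one hn]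

/-- Bridge to the tree: the odd-`p` formula `polyRootCountMod_quadratic_odd` at
`(a, b, c) = (1, 0, 1)` (`Δ = -4`, `(Δ/p) = χ₋₄(p)`) is the tree's named fact
`polyRootCountMod_X_sq_add_one` (`ω_{x²+1}(p) = 1 + χ₋₄(p)` for odd primes `p`;
`Literature/NumberTheory/Sieve/BatemanHorn.lean`). [cite: AletheiaZomleferFukshanskyGarcia2020, §6.5 and §3.4] -/
theorem polyRootCountMod_X_sq_add_one_of_quadratic_odd (h : polyRootCountMod_quadratic_odd) :
    polyRootCountMod_X_sq_add_one := by
  intro p hp hp2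
  have hlt : 2 < p := lt_of_le_of_ne hp.two_le (Ne.symm hp2)
  have := h 1 0 1 one_pos (by decide) p hp hlt
  have hpoly : (![C 1 * X ^ 2 + C 0 * X + C 1] : Fin 1 → ℤ[X]) = ![X ^ 2 + 1] := by simp
  have h1 : ¬((p : ℤ) ∣ 1) := fun hd ↦ by
    have := Int.eq_one_of_dvd_one (by positivity) hd
    omega
  rw [hpoly, if_neg h1, show (0 : ℤ) ^ 2 - 4 * 1 * 1 = -4 by norm_num,
    jacobiSym_neg_four (hp.odd_of_ne_two hp2)] at this
  exact this

/-- Faithfulness check: Conjecture F specialised to `a = 1, b = 0, c = 1` (`ε = 1/2`, empty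
first product, `Δ = -4`, `(Δ/p) = χ₋₄(p)`) is exactly the tree's Hardy–Littlewood Conjecture E
for `n² + 1` (`HardyLittlewoodConjE`, Literature `ParityBatemanHorn.lean`).
[cite: AletheiaZomleferFukshanskyGarcia2020, §6.5 and §3.4] -/
theorem HardyLittlewoodConjF.conjE (h : HardyLittlewoodConjF) : HardyLittlewoodConjE := by
  have hsq : ¬IsSquare ((0 : ℤ) ^ 2 - 4 * 1 * 1) := by
    rintro ⟨r, hr⟩
    nlinarith [mul_self_nonneg r]
  obtain ⟨-, S, hS, hQ⟩ := h 1 0 1 one_pos (by decide) (by decide) hsq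
  refine ⟨S, ?_, ?_⟩
  · refine hS.congr fun x ↦ prod_congr ?_ fun p hp ↦ ?_
    · refine filter_congr fun p hp ↦ ?_
      simp only [and_iff_left_iff_imp]
      intro _ h1
      have := Int.eq_one_of_dvd_one (by positivity) h1
      have := (Nat.mem_primesLE.mp hp).2.one_lt
      omega
    · simp only [mem_filter, Nat.mem_primesLE] at hp
      rw [show (0 : ℤ) ^ 2 - 4 * 1 * 1 = -4 by norm_num,
        jacobiSym_neg_four (hp.1.2.odd_of_ne_two (by omega))]
  · have hpoly : (![C 1 * X ^ 2 + C 0 * X + C 1] : Fin 1 → ℤ[X]) = ![X ^ 2 + 1] := by simp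
    have h1 : ¬Even ((1 : ℤ) + 0) := by decide
    have h2 : ((1 : ℤ).gcd 0).primeFactors = ∅ := by
      rw [show (1 : ℤ).gcd 0 = 1 by decide, Nat.primeFactors_one]
    simp only [hpoly, polyPrimeCount_X_sq_add_one, h1, if_false, h2, filter_empty, prod_empty,
      mul_one] at hQ
    convert hQ using 2 with x
    ring

/-! ### §7.1 — twin primes -/

/-- The twin-prime system `f₁(t) = t`, `f₂(t) = t + 2` of §7.1. [cite: AletheiaZomleferFukshanskyGarcia2020, §7.1] -/
abbrev twinSystem : Fin 2 → ℤ[X] := ![X, X + 2]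

/-- **§7.1**: `ω_f(2) = 1` and `ω_f(p) = 2` for `p ≥ 3`, `f(t) = t(t + 2)`.
[cite: AletheiaZomleferFukshanskyGarcia2020, §7.1 (display for ω_f)] -/
theorem polyRootCountMod_twinSystem {p : ℕ} (hp : p.Prime) :
    polyRootCountMod twinSystem p = if p = 2 then 1 else 2 := by
  unfold polyRootCountMod twinSystem
  simp only [Fin.prod_univ_two, Matrix.cons_val_zero, Matrix.cons_val_one, eval_X, eval_add,
    eval_ofNat]
  split_ifs with h2
  · subst h2
    decide
  · have h3 : 3 ≤ p := by have := hp.two_le; omega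
    have hset : (range p).filter (fun n : ℕ ↦ (p : ℤ) ∣ (n : ℤ) * ((n : ℤ) + 2)) =
        {0, p - 2} := by
      ext n
      simp only [mem_filter, mem_range, mem_insert, mem_singleton]
      have hcast : ((p : ℤ) ∣ (n : ℤ) * ((n : ℤ) + 2)) ↔ p ∣ n * (n + 2) := by
        rw [← Int.natCast_dvd_natCast]; push_cast; rfl
      rw [hcast, hp.dvd_mul]
      constructor
      · rintro ⟨hn, h | h⟩
        · exact Or.inl (Nat.eq_zero_of_dvd_of_lt h hn)
        · obtain ⟨c, hc⟩ := h
          right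
          rcases c with _ | _ | c
          · omega
          · omega
          · nlinarith
      · rintro (rfl | rfl)
        · exact ⟨by omega, Or.inl (dvd_zero p)⟩
        · refine ⟨by omega, Or.inr ?_⟩
          rw [show p - 2 + 2 = p by omega]
    rw [hset, card_pair (by omega)]

/-- **§7.1**: `C(t, t+2) = 2 ∏_{p ≥ 3} p(p-2)/(p-1)² = 2C₂` at the level of ordered partial
products: for `x ≥ 2` the Bateman–Horn partial product of the twin system equals
`2 · ∏_{2 < p ≤ x} (1 - 1/(p-1)²)` (`twinPrimeConstPartial`).
[cite: AletheiaZomleferFukshanskyGarcia2020, §7.1 (display for C(f₁, f₂))] -/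
theorem batemanHornPartial_twinSystem {x : ℕ} (hx : 2 ≤ x) :
    batemanHornPartial twinSystem x = 2 * twinPrimeConstPartial x := by
  unfold batemanHornPartial twinPrimeConstPartial
  rw [← prod_filter_mul_prod_filter_not (Nat.primesLE x) (2 < ·), mul_comm]
  congr 1
  · have h2 : (Nat.primesLE x).filter (fun p ↦ ¬2 < p) = {2} := by
      ext p
      simp only [mem_filter, Nat.mem_primesLE, mem_singleton, not_lt]
      constructor
      · rintro ⟨⟨-, hp⟩, h2⟩
        exact le_antisymm h2 hp.two_le
      · rintro rfl
        exact ⟨⟨hx, Nat.prime_two⟩, le_rfl⟩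
    rw [h2, prod_singleton, polyRootCountMod_twinSystem Nat.prime_two, if_pos rfl,
      Fintype.card_fin]
    norm_num
  · refine prod_congr rfl fun p hp ↦ ?_
    simp only [mem_filter, Nat.mem_primesLE] at hp
    obtain ⟨⟨-, hpp⟩, hp2⟩ := hp
    rw [polyRootCountMod_twinSystem hpp, if_neg (by omega), Fintype.card_fin]
    have h0 : (p : ℝ) ≠ 0 := by positivity
    have h1 : (p : ℝ) - 1 ≠ 0 := by
      have : (1 : ℝ) < p := by exact_mod_cast hpp.one_lt
      linarith
    push_cast
    field_simp
    ring

/-- **§7.1**: `C(t, t+2) = 2C₂`, i.e. the Bateman–Horn ordered product of the twin system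
converges to `2 · twinPrimeConst`, given the tree's convergence fact
`tendsto_twinPrimeConstPartial` for `C₂ = ∏_{p>2} (1 - 1/(p-1)²)`.
[cite: AletheiaZomleferFukshanskyGarcia2020, §7.1 (C(f₁, f₂) = 2C₂)] -/
theorem hasBatemanHornConst_twinSystem (h : tendsto_twinPrimeConstPartial) :
    HasBatemanHornConst twinSystem (2 * twinPrimeConst) := by
  unfold HasBatemanHornConst
  refine (h.const_mul 2).congr' ?_
  filter_upwards [eventually_ge_atTop 2] with x hx
  exact (batemanHornPartial_twinSystem hx).symm

/-- The twin system satisfies the Bateman–Horn hypotheses (`t`, `t + 2` irreducible, monic,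
distinct; `ω(2) = 1 < 2`, `ω(p) = 2 < p` for `p ≥ 3`). [cite: AletheiaZomleferFukshanskyGarcia2020, §7.1] -/
theorem isBatemanHornSystem_twinSystem : IsBatemanHornSystem twinSystem where
  irreducible i := by
    fin_cases i
    · exact prime_X.irreducible
    · simpa using irreducible_X_sub_C (-2 : ℤ)
  leadingCoeff_pos i := by
    fin_cases i
    · simp
    · have h : ((X : ℤ[X]) + 2).leadingCoeff = 1 := by
        simpa using (monic_X_add_C (2 : ℤ)).leadingCoeff
      simp [h]
  pairwise_not_associated := by
    have key : ¬Associated (X : ℤ[X]) (X + 2) := by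
      intro h
      have h1 : (X : ℤ[X]) ∣ X + 2 - X := dvd_sub h.dvd dvd_rfl
      rw [add_sub_cancel_left, X_dvd_iff, coeff_ofNat_zero] at h1
      norm_num at h1
    intro i j hij
    fin_cases i <;> fin_cases j
    · exact absurd rfl hij
    · simpa using key
    · simpa using fun h ↦ key h.symm
    · exact absurd rfl hij
  hasNoFixedPrimeDivisor p hp := by
    rw [polyRootCountMod_twinSystem hp]
    split_ifs with h
    · omega
    · have := hp.two_le; omega

/-- `Q(t, t+2; x) = π₂(x)` (`twinPrimeCount`, the number of `p ≤ x` with `p`, `p + 2` prime).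
[cite: AletheiaZomleferFukshanskyGarcia2020, §7.1 (π₂(x) = Q(f₁, f₂; x))] -/
theorem polyPrimeCount_twinSystem (x : ℕ) : polyPrimeCount twinSystem x = twinPrimeCount x := by
  unfold polyPrimeCount twinPrimeCount
  congr 1
  ext n
  simp only [mem_filter, mem_range, Fin.forall_fin_two, Matrix.cons_val_zero, Matrix.cons_val_one,
    eval_X, eval_add, eval_ofNat, Int.toNat_natCast]
  have h2 : ((n : ℤ) + 2).toNat = n + 2 := by
    rw [show ((n : ℤ) + 2) = ((n + 2 : ℕ) : ℤ) by push_cast; ring, Int.toNat_natCast]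
  rw [h2]
  constructor
  · rintro ⟨hn, ⟨-, hp⟩, -, hq⟩
    exact ⟨hn, hp, hq⟩
  · rintro ⟨hn, hp, hq⟩
    exact ⟨hn, ⟨by exact_mod_cast hp.pos, hp⟩, by positivity, hq⟩

/-- **§7.1: Bateman–Horn ⇒ the Hardy–Littlewood twin prime asymptotic**
`π₂(x) ∼ 2C₂ x/(log x)²` (`C₂ = twinPrimeConst`), given the tree's convergence fact
`tendsto_twinPrimeConstPartial` (which identifies the Bateman–Horn constant of the twin system as
`2C₂` by uniqueness of limits). [cite: AletheiaZomleferFukshanskyGarcia2020, §7.1 (π₂(x) ∼ 2C₂ x/(log x)²)] -/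
theorem twinPrimeCount_isEquivalent_of_batemanHorn (hC₂ : tendsto_twinPrimeConstPartial)
    (hBH : BatemanHornConjecture) :
    (fun x : ℕ ↦ (twinPrimeCount x : ℝ)) ~[atTop]
      fun x : ℕ ↦ 2 * twinPrimeConst * x / Real.log x ^ 2 := by
  obtain ⟨C, hC, hQ⟩ := hBH 2 twinSystem isBatemanHornSystem_twinSystem
  have hCeq : C = 2 * twinPrimeConst :=
    tendsto_nhds_unique hC (hasBatemanHornConst_twinSystem hC₂)
  convert hQ using 2 with x x
  · rw [polyPrimeCount_twinSystem]
  · have hdeg : ((X : ℤ[X]) + 2).natDegree = 1 := by simpa using natDegree_X_add_C (2 : ℤ)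
    simp [twinSystem, hCeq, hdeg]

/-- `x/(log x)² → ∞` along the natural numbers (from Mathlib's `(log x)^2 = o(x)`). [folklore] -/
theorem tendsto_natCast_div_log_sq_atTop :
    Tendsto (fun x : ℕ ↦ (x : ℝ) / Real.log x ^ 2) atTop atTop := by
  have h2 : Tendsto (fun x : ℝ ↦ Real.log x ^ (2 : ℝ) / x ^ (1 : ℝ)) atTop (𝓝 0) :=
    (isLittleO_log_rpow_rpow_atTop 2 one_pos).tendsto_div_nhds_zero
  have h3 : Tendsto (fun x : ℝ ↦ Real.log x ^ 2 / x) atTop (𝓝[>] 0) := by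
    refine tendsto_nhdsWithin_iff.mpr ⟨?_, ?_⟩
    · refine h2.congr' ?_
      filter_upwards [eventually_gt_atTop 0] with x hx
      rw [Real.rpow_one, Real.rpow_two]
    · filter_upwards [eventually_gt_atTop 1] with x hx
      exact div_pos (pow_pos (Real.log_pos hx) 2) (by linarith)
  refine ((h3.inv_tendsto_nhdsGT_zero).comp tendsto_natCast_atTop_atTop).congr fun x ↦ ?_
  simp [inv_div]

/-- If `π₂(x) → ∞` then there are infinitely many twin primes (the tree's
`Literature.NumberTheory.Sieve.TwinPrimeConjecture`: beyond every `n` a twin pair). [folklore] -/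
theorem twinPrimeConjecture_of_tendsto
    (h : Tendsto (fun x : ℕ ↦ (twinPrimeCount x : ℝ)) atTop atTop) :
    Sieve.TwinPrimeConjecture := by
  intro n
  by_contra hcon
  push Not at hcon
  have hbound : ∀ x, (twinPrimeCount x : ℝ) ≤ (n + 1 : ℕ) := by
    intro x
    unfold twinPrimeCount
    exact_mod_cast (card_le_card (fun p hp ↦ by
      simp only [mem_filter, mem_range] at hp ⊢
      by_contra hpn
      exact hcon p (by omega) hp.2.1 hp.2.2)).trans (card_range (n + 1)).le
  obtain ⟨x, hx⟩ := (h.eventually (eventually_gt_atTop ((n + 1 : ℕ) : ℝ))).exists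
  exact absurd hx (not_lt.mpr (hbound x))

/-- **§7.1**: in particular Bateman–Horn implies the twin prime conjecture, given the tree's
facts `twinPrimeConst_pos` (`C₂ > 0`) and `tendsto_twinPrimeConstPartial`. PROVED (from
`twinPrimeCount_isEquivalent_of_batemanHorn` and `x/(log x)² → ∞`).
[cite: AletheiaZomleferFukshanskyGarcia2020, §7.1] -/
theorem twinPrimeConjecture_of_batemanHorn (hpos : twinPrimeConst_pos)
    (hC₂ : tendsto_twinPrimeConstPartial) (hBH : BatemanHornConjecture) :
    Sieve.TwinPrimeConjecture := by
  refine twinPrimeConjecture_of_tendsto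
    ((twinPrimeCount_isEquivalent_of_batemanHorn hC₂ hBH).symm.tendsto_atTop ?_)
  have := tendsto_natCast_div_log_sq_atTop.const_mul_atTop (mul_pos two_pos hpos)
  simpa [mul_div_assoc] using this

/-! ### §7.2 — prime pairs `p, p + k` -/

/-- `π_k(x) = #{p ≤ x : p and p + k prime}` (§7.2); `π₂ = twinPrimeCount`
(`twinPrimeCount_eq_primePairCount_two`). [cite: AletheiaZomleferFukshanskyGarcia2020, §7.2 (π_k)] -/
def primePairCount (k x : ℕ) : ℕ :=
  #{p ∈ range (x + 1) | p.Prime ∧ (p + k).Prime}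

/-- `π₂ = π_{k=2}` (definitional). [folklore] -/
theorem twinPrimeCount_eq_primePairCount_two : twinPrimeCount = primePairCount 2 := rfl

/-- Bridge to the tree's `k`-tuple count: `π_k(x) = π_{{0,k}}(x)` (`primeTupleCount`, which runs
over `1 ≤ n ≤ x`; the term `n = 0` of `primePairCount` is not prime). In particular (with
`k = 2`) this proves the tree's named fact `twinPrimeCount_eq_primeTupleCount`. [folklore] -/
theorem primePairCount_eq_primeTupleCount (k x : ℕ) :
    primePairCount k x = primeTupleCount {0, (k : ℤ)} x := by
  unfold primePairCount primeTupleCount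
  have hkey : ∀ n : ℕ, (∀ h ∈ ({0, (k : ℤ)} : Finset ℤ), 0 < (n : ℤ) + h ∧ ((n : ℤ) + h).toNat.Prime) ↔
      n.Prime ∧ (n + k).Prime := by
    intro n
    simp only [mem_insert, mem_singleton, forall_eq_or_imp, forall_eq, add_zero, Int.toNat_natCast]
    rw [show ((n : ℤ) + k) = ((n + k : ℕ) : ℤ) by push_cast; ring, Int.toNat_natCast]
    constructor
    · rintro ⟨⟨-, hp⟩, -, hq⟩
      exact ⟨hp, hq⟩
    · rintro ⟨hp, hq⟩
      exact ⟨⟨by exact_mod_cast hp.pos, hp⟩, by exact_mod_cast (hp.pos.trans_le le_self_add), hq⟩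
  simp_rw [hkey]
  congr 1
  ext n
  simp only [mem_filter, mem_range, mem_Icc, Nat.lt_succ_iff]
  constructor
  · rintro ⟨hn, hp, hq⟩
    exact ⟨⟨hp.one_le, hn⟩, hp, hq⟩
  · rintro ⟨⟨-, hn⟩, hp, hq⟩
    exact ⟨hn, hp, hq⟩

/-- Discharge of the tree's named fact `twinPrimeCount_eq_primeTupleCount`
(`Literature/NumberTheory/Sieve/SingularSeries.lean`): `π₂(x) = π_{{0,2}}(x)`. [folklore] -/
theorem twinPrimeCount_eq_primeTupleCount_holds : twinPrimeCount_eq_primeTupleCount :=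
  fun x ↦ primePairCount_eq_primeTupleCount 2 x

/-- Ordered partial products `∏_{p ≤ x, p ∤ k} p(p-2)/(p-1)²` of the second factor of `C_k`
(§7.2, display (7.2.2)); by (7.2.3) each factor is `1 - 1/(p-1)²`, so the product converges absolutely.
[cite: AletheiaZomleferFukshanskyGarcia2020, §7.2 (7.2.2)–(7.2.3)] -/
def primePairConstPartial (k x : ℕ) : ℝ :=
  ∏ p ∈ (Nat.primesLE x).filter (¬· ∣ k), (p : ℝ) * ((p : ℝ) - 2) / ((p : ℝ) - 1) ^ 2

/-- The prime-pair constants of §7.2 (defined in the source for even `k` only):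
`C_k = ∏_{p ∣ k, p ≥ 3} p/(p-1) · ∏_{p ∤ k} p(p-2)/(p-1)²`, the infinite product taken as an
ordered limit (D-SIEVE-1). `C₂ ≈ 0.660161815` is the twin prime constant
(`primePairConst_two_pow`). [cite: AletheiaZomleferFukshanskyGarcia2020, §7.2 (7.2.2)] -/
def primePairConst (k : ℕ) : ℝ :=
  (∏ p ∈ k.primeFactors.filter (2 < ·), (p : ℝ) / ((p : ℝ) - 1)) *
    limUnder atTop (primePairConstPartial k)

/-- **§7.2**: for even `k ≥ 2` the product (7.2.2) defining `C_k` converges (absolutely, since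
`p(p-2)/(p-1)² = 1 - 1/(p-1)²` (7.2.3) and `∑ 1/p² < ∞`) to a positive limit.
[cite: AletheiaZomleferFukshanskyGarcia2020, §7.2 (7.2.2)–(7.2.3)] -/
def tendsto_primePairConstPartial : Prop :=
  ∀ k : ℕ, Even k → k ≠ 0 →
    ∃ L : ℝ, 0 < L ∧ Tendsto (primePairConstPartial k) atTop (𝓝 L)

/-- For `k = 2^{m+1}` the partial products of `C_k` are those of the twin prime constant
(`p ∤ 2^{m+1}` iff `p > 2` for primes `p`, and `p(p-2)/(p-1)² = 1 - 1/(p-1)²`). [folklore] -/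
theorem primePairConstPartial_two_pow (m : ℕ) :
    primePairConstPartial (2 ^ (m + 1)) = twinPrimeConstPartial := by
  funext x
  unfold primePairConstPartial twinPrimeConstPartial
  refine prod_congr ?_ fun p hp ↦ ?_
  · refine filter_congr fun p hp ↦ ?_
    have hpp := (Nat.mem_primesLE.mp hp).2
    have h2 := hpp.two_le
    constructor
    · intro hn
      refine lt_of_le_of_ne h2 ?_
      rintro rfl
      exact hn (dvd_pow_self 2 (Nat.succ_ne_zero m))
    · intro hlt hdvd
      have := (Nat.prime_dvd_prime_iff_eq hpp Nat.prime_two).mp (hpp.dvd_of_dvd_pow hdvd)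
      omega
  · simp only [mem_filter, Nat.mem_primesLE] at hp
    have h1 : (p : ℝ) - 1 ≠ 0 := by
      have : (1 : ℝ) < p := by exact_mod_cast hp.1.2.one_lt
      linarith
    field_simp
    ring

/-- **§7.2**: "`C_k` is minimized when `k` is a power of two, in which case
`C₂ = C₄ = C₈ = C₁₆ = ⋯`" (second observation after (7.2.3)): `C_{2^{m+1}} = C₂ = twinPrimeConst`.
[cite: AletheiaZomleferFukshanskyGarcia2020, §7.2 (observations after (7.2.3))] -/
theorem primePairConst_two_pow (m : ℕ) : primePairConst (2 ^ (m + 1)) = twinPrimeConst := by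
  unfold primePairConst twinPrimeConst
  rw [primePairConstPartial_two_pow, Nat.primeFactors_prime_pow (Nat.succ_ne_zero m) Nat.prime_two]
  simp [Finset.filter_singleton]

/-- **§7.2, display (7.2.1)**: for even `k ≥ 2` and `f₁ = t`, `f₂ = t + k` (`ω_f(p) = 1` if
`p ∣ k`, `2` if `p ∤ k`), `C(f₁, f₂) = ∏_{p∣k} p/(p-1) ∏_{p∤k} p(p-2)/(p-1)² = 2C_k`.
[cite: AletheiaZomleferFukshanskyGarcia2020, §7.2 (7.2.1)–(7.2.2)] -/
def hasBatemanHornConst_primePair : Prop :=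
  ∀ k : ℕ, Even k → k ≠ 0 →
    HasBatemanHornConst ![(X : ℤ[X]), X + C (k : ℤ)] (2 * primePairConst k)

/-- **§7.2**: Bateman–Horn predicts `π_k(x) ∼ 2C_k ∫₂ˣ dt/(log t)² ∼ 2C_k x/(log x)²` for
every even `k ≥ 2` (in particular Polignac's conjecture).
[cite: AletheiaZomleferFukshanskyGarcia2020, §7.2 (display for π_k(x) after (7.2.3))] -/
def primePairCount_isEquivalent_of_batemanHorn : Prop :=
  BatemanHornConjecture → ∀ k : ℕ, Even k → k ≠ 0 →
    (fun x : ℕ ↦ (primePairCount k x : ℝ)) ~[atTop]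
      fun x : ℕ ↦ 2 * primePairConst k * x / Real.log x ^ 2

/-! ### §7.3 — Sophie Germain primes -/

/-- The Sophie Germain system `f₁(t) = t`, `f₂(t) = 2t + 1` of §7.3.
[cite: AletheiaZomleferFukshanskyGarcia2020, §7.3] -/
abbrev sgSystem : Fin 2 → ℤ[X] := ![X, C 2 * X + C 1]

/-- `2t + 1` is irreducible in `ℤ[t]` (primitive of degree one; Gauss's lemma). [folklore] -/
theorem irreducible_two_mul_X_add_one : Irreducible (C 2 * X + C 1 : ℤ[X]) := by
  have hprim : (C 2 * X + C 1 : ℤ[X]).IsPrimitive := by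
    rw [isPrimitive_iff_isUnit_of_C_dvd]
    intro r hr
    have := (C_dvd_iff_dvd_coeff r _).mp hr 0
    simp at this
    exact isUnit_of_dvd_one this
  rw [hprim.irreducible_iff_irreducible_map_fraction_map (K := ℚ)]
  refine irreducible_of_degree_eq_one ?_
  simp only [Polynomial.map_add, Polynomial.map_mul, map_C, map_X]
  exact degree_linear (by norm_num)

/-- **§7.3**: `ω_f(2) = 1` and `ω_f(p) = 2` for odd `p`, `f(t) = t(2t + 1)` (`f` vanishes at
`0` and `(p-1)/2`). [cite: AletheiaZomleferFukshanskyGarcia2020, §7.3 (display for ω_f)] -/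
theorem polyRootCountMod_sgSystem {p : ℕ} (hp : p.Prime) :
    polyRootCountMod sgSystem p = if p = 2 then 1 else 2 := by
  unfold polyRootCountMod sgSystem
  simp only [Fin.prod_univ_two, Matrix.cons_val_zero, Matrix.cons_val_one, eval_X, eval_add,
    eval_mul, eval_C]
  split_ifs with h2
  · subst h2
    decide
  · have h3 : 3 ≤ p := by have := hp.two_le; omega
    have hodd : p % 2 = 1 := Nat.odd_iff.mp (hp.odd_of_ne_two h2)
    have hset : (range p).filter (fun n : ℕ ↦ (p : ℤ) ∣ (n : ℤ) * (2 * (n : ℤ) + 1)) =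
        {0, (p - 1) / 2} := by
      ext n
      simp only [mem_filter, mem_range, mem_insert, mem_singleton]
      have hcast : ((p : ℤ) ∣ (n : ℤ) * (2 * (n : ℤ) + 1)) ↔ p ∣ n * (2 * n + 1) := by
        rw [← Int.natCast_dvd_natCast]; push_cast; rfl
      rw [hcast, hp.dvd_mul]
      constructor
      · rintro ⟨hn, h | h⟩
        · exact Or.inl (Nat.eq_zero_of_dvd_of_lt h hn)
        · obtain ⟨c, hc⟩ := h
          right
          rcases c with _ | _ | c
          · omega
          · omega
          · nlinarith
      · rintro (rfl | rfl)
        · exact ⟨by omega, Or.inl (dvd_zero p)⟩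
        · refine ⟨by omega, Or.inr ?_⟩
          rw [show 2 * ((p - 1) / 2) + 1 = p by omega]
    rw [hset, card_pair (by omega)]

/-- The Sophie Germain system has the same local factors as the twin system (same `ω_f`), so
the same Bateman–Horn partial products. [cite: AletheiaZomleferFukshanskyGarcia2020, §7.3] -/
theorem batemanHornPartial_sgSystem (x : ℕ) :
    batemanHornPartial sgSystem x = batemanHornPartial twinSystem x := by
  unfold batemanHornPartial
  refine prod_congr rfl fun p hp ↦ ?_
  have hpp := (Nat.mem_primesLE.mp hp).2
  rw [polyRootCountMod_sgSystem hpp, polyRootCountMod_twinSystem hpp]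

/-- **§7.3**: `C(t, 2t+1) = 2 ∏_{p ≠ 2} p(p-2)/(p-1)² ≈ 1.32032 = 2C₂` (as an ordered limit),
given the tree's convergence fact `tendsto_twinPrimeConstPartial`. PROVED.
[cite: AletheiaZomleferFukshanskyGarcia2020, §7.3 (display for C(f₁, f₂))] -/
theorem hasBatemanHornConst_sophieGermain (h : tendsto_twinPrimeConstPartial) :
    HasBatemanHornConst sgSystem (2 * twinPrimeConst) := by
  unfold HasBatemanHornConst
  rw [show batemanHornPartial sgSystem = batemanHornPartial twinSystem from
    funext batemanHornPartial_sgSystem]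
  exact hasBatemanHornConst_twinSystem h

/-- The Sophie Germain system satisfies the Bateman–Horn hypotheses ("`f` does not vanish
identically modulo any prime since `f(1) ≡ 1 (mod 2)` and `f` has at most two roots modulo any
odd prime"). [cite: AletheiaZomleferFukshanskyGarcia2020, §7.3] -/
theorem isBatemanHornSystem_sgSystem : IsBatemanHornSystem sgSystem where
  irreducible i := by
    fin_cases i
    · exact prime_X.irreducible
    · exact irreducible_two_mul_X_add_one
  leadingCoeff_pos i := by
    fin_cases i
    · simp
    · show 0 < (C 2 * X + C 1 : ℤ[X]).leadingCoeff
      rw [leadingCoeff_linear two_ne_zero]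
      norm_num
  pairwise_not_associated := by
    have key : ¬Associated (X : ℤ[X]) (C 2 * X + C 1) := by
      intro h
      have h1 := X_dvd_iff.mp h.dvd
      simp at h1
    intro i j hij
    fin_cases i <;> fin_cases j
    · exact absurd rfl hij
    · simpa using key
    · simpa using fun h ↦ key h.symm
    · exact absurd rfl hij
  hasNoFixedPrimeDivisor p hp := by
    rw [polyRootCountMod_sgSystem hp]
    split_ifs with h
    · omega
    · have := hp.two_le; omega

/-- `Q(t, 2t+1; x) = #{p ≤ x : p and 2p + 1 prime}` (the Sophie Germain prime count).
[cite: AletheiaZomleferFukshanskyGarcia2020, §7.3] -/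
theorem polyPrimeCount_sgSystem (x : ℕ) :
    polyPrimeCount sgSystem x = #{p ∈ range (x + 1) | p.Prime ∧ (2 * p + 1).Prime} := by
  unfold polyPrimeCount
  congr 1
  ext n
  simp only [mem_filter, mem_range, Fin.forall_fin_two, Matrix.cons_val_zero, Matrix.cons_val_one,
    eval_X, eval_add, eval_mul, eval_C, Int.toNat_natCast]
  have h2 : (2 * (n : ℤ) + 1).toNat = 2 * n + 1 := by
    rw [show (2 * (n : ℤ) + 1) = ((2 * n + 1 : ℕ) : ℤ) by push_cast; ring, Int.toNat_natCast]
  rw [h2]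
  constructor
  · rintro ⟨hn, ⟨-, hp⟩, -, hq⟩
    exact ⟨hn, hp, hq⟩
  · rintro ⟨hn, hp, hq⟩
    exact ⟨hn, ⟨by exact_mod_cast hp.pos, hp⟩, by positivity, hq⟩

/-- **§7.3**: Bateman–Horn implies the asymptotic count of Sophie Germain primes,
`#{p ≤ x : p, 2p + 1 prime} = Q(t, 2t+1; x) ∼ 2C₂ x/(log x)²` ("the same asymptotic prediction
as in the twin-prime case"), given the tree's fact `tendsto_twinPrimeConstPartial`. PROVED.
[cite: AletheiaZomleferFukshanskyGarcia2020, §7.3] -/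
theorem sophieGermain_isEquivalent_of_batemanHorn (hC₂ : tendsto_twinPrimeConstPartial)
    (hBH : BatemanHornConjecture) :
    (fun x : ℕ ↦ (#{p ∈ range (x + 1) | p.Prime ∧ (2 * p + 1).Prime} : ℝ)) ~[atTop]
      fun x : ℕ ↦ 2 * twinPrimeConst * x / Real.log x ^ 2 := by
  obtain ⟨C, hC, hQ⟩ := hBH 2 sgSystem isBatemanHornSystem_sgSystem
  have hCeq : C = 2 * twinPrimeConst :=
    tendsto_nhds_unique hC (hasBatemanHornConst_sophieGermain hC₂)
  convert hQ using 2 with x x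
  · rw [polyPrimeCount_sgSystem]
  · have hdeg : (2 * X + 1 : ℤ[X]).natDegree = 1 := by
      simpa using natDegree_linear (a := (2 : ℤ)) (b := 1) two_ne_zero
    simp [sgSystem, hCeq, hdeg]

/-- Hence Bateman–Horn (with `C₂ > 0`) implies that there are infinitely many Sophie Germain
primes. PROVED. [cite: AletheiaZomleferFukshanskyGarcia2020, §7.3] -/
theorem sophieGermain_infinite_of_batemanHorn (hpos : twinPrimeConst_pos)
    (hC₂ : tendsto_twinPrimeConstPartial) (hBH : BatemanHornConjecture) :
    {p : ℕ | p.Prime ∧ (2 * p + 1).Prime}.Infinite := by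
  have hlim : Tendsto (fun x : ℕ ↦ (#{p ∈ range (x + 1) | p.Prime ∧ (2 * p + 1).Prime} : ℝ))
      atTop atTop := by
    refine (sophieGermain_isEquivalent_of_batemanHorn hC₂ hBH).symm.tendsto_atTop ?_
    have := tendsto_natCast_div_log_sq_atTop.const_mul_atTop (mul_pos two_pos hpos)
    simpa [mul_div_assoc] using this
  refine Set.infinite_of_forall_exists_gt fun n ↦ ?_
  by_contra hcon
  push Not at hcon
  have hbound : ∀ x, (#{p ∈ range (x + 1) | p.Prime ∧ (2 * p + 1).Prime} : ℝ) ≤ (n + 1 : ℕ) := by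
    intro x
    exact_mod_cast (card_le_card (fun p hp ↦ by
      simp only [mem_filter, mem_range] at hp ⊢
      have := hcon p hp.2
      omega)).trans (card_range (n + 1)).le
  obtain ⟨x, hx⟩ := (hlim.eventually (eventually_gt_atTop ((n + 1 : ℕ) : ℝ))).exists
  exact absurd hx (not_lt.mpr (hbound x))

/-! ### §7.4 — Cunningham chains -/

/-- The terms of the Cunningham chain of the first kind started at `q`:
`c₀ = q`, `c_{i+1} = 2cᵢ + 1` (so `cᵢ = 2ⁱ q + (2ⁱ - 1)`, `cunninghamTerm_add_one`).
[cite: AletheiaZomleferFukshanskyGarcia2020, §7.4] -/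
def cunninghamTerm (q : ℕ) : ℕ → ℕ
  | 0 => q
  | i + 1 => 2 * cunninghamTerm q i + 1

/-- Closed form `cᵢ + 1 = 2ⁱ (q + 1)`, i.e. `cᵢ = 2ⁱ q + (2ⁱ - 1)` (§7.4, display).
[cite: AletheiaZomleferFukshanskyGarcia2020, §7.4 (p_{i+1} = 2ⁱ p₁ + (2ⁱ - 1))] -/
theorem cunninghamTerm_add_one (q i : ℕ) : cunninghamTerm q i + 1 = 2 ^ i * (q + 1) := by
  induction i with
  | zero => simp [cunninghamTerm]
  | succ i ih => rw [cunninghamTerm, pow_succ]; linarith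

/-- `q, 2q+1, …` is a Cunningham chain (of the first kind) of length `n`: its first `n` terms
are prime. [cite: AletheiaZomleferFukshanskyGarcia2020, §7.4] -/
def IsCunninghamChain (q n : ℕ) : Prop :=
  ∀ i < n, (cunninghamTerm q i).Prime

/-- For an odd prime `q`, `q ∣ c_{q-1} = 2^{q-1} q + (2^{q-1} - 1)` by Fermat's little theorem
(§7.4). [cite: AletheiaZomleferFukshanskyGarcia2020, §7.4 (Fermat argument)] -/
theorem dvd_cunninghamTerm {q : ℕ} (hq : q.Prime) (hq2 : q ≠ 2) :
    q ∣ cunninghamTerm q (q - 1) := by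
  haveI := Fact.mk hq
  rw [← ZMod.natCast_eq_zero_iff, ← add_left_inj (1 : ZMod q), ← Nat.cast_add_one,
    cunninghamTerm_add_one]
  push_cast
  have h2 : (2 : ZMod q) ≠ 0 := by
    intro h
    have := (ZMod.natCast_eq_zero_iff 2 q).mp (by exact_mod_cast h)
    exact hq2 ((Nat.prime_dvd_prime_iff_eq hq Nat.prime_two).mp this)
  rw [ZMod.pow_card_sub_one_eq_one h2, ZMod.natCast_self]
  ring

/-- Hence `c_{q-1}` is not prime for an odd prime `q` (it exceeds `q` and is divisible by `q`).
[cite: AletheiaZomleferFukshanskyGarcia2020, §7.4] -/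
theorem not_prime_cunninghamTerm {q : ℕ} (hq : q.Prime) (hq2 : q ≠ 2) :
    ¬(cunninghamTerm q (q - 1)).Prime := by
  intro hprime
  have heq := (Nat.prime_dvd_prime_iff_eq hq hprime).mp (dvd_cunninghamTerm hq hq2)
  have h3 : 3 ≤ q := by
    have := hq.two_le
    omega
  have hbig : q + 1 < cunninghamTerm q (q - 1) + 1 := by
    rw [cunninghamTerm_add_one]
    calc q + 1 < 2 * (q + 1) := by omega
      _ ≤ 2 ^ (q - 1) * (q + 1) := by
        gcongr
        calc (2 : ℕ) = 2 ^ 1 := by norm_num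
          _ ≤ 2 ^ (q - 1) := Nat.pow_le_pow_right (by norm_num) (by omega)
  omega

/-- **§7.4**: "a Cunningham chain starting with an odd prime `p₁` cannot have more than
`p₁ - 1` terms" — an infinite Cunningham chain cannot exist.
[cite: AletheiaZomleferFukshanskyGarcia2020, §7.4 (bound on the length of a chain)] -/
theorem IsCunninghamChain.length_lt {q n : ℕ} (hq : q.Prime) (hq2 : q ≠ 2)
    (h : IsCunninghamChain q n) : n < q := by
  by_contra hn
  push Not at hn
  exact not_prime_cunninghamTerm hq hq2 (h (q - 1) (by have := hq.one_lt; omega))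

/-- **§7.4**: the existence of arbitrarily long Cunningham chains follows from Bateman–Horn
(polynomials `f₁ = t`, `f_{i+1} = 2fᵢ + 1`), indeed with infinitely many chains of each length.
[cite: AletheiaZomleferFukshanskyGarcia2020, §7.4 (chains from Bateman–Horn)] -/
def isCunninghamChain_infinite_of_batemanHorn : Prop :=
  BatemanHornConjecture → ∀ n : ℕ, {q : ℕ | IsCunninghamChain q n}.Infinite

/-! ### §7.5 — the Green–Tao theorem -/

/-- **§7.5, Theorem 7.5.1 from Bateman–Horn**: with `f_i(t) = t + (i-1)a`, `a = p_k#`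
(`ω_f(p) = 1` if `p ∣ a`, `min{k, p}` if `p ∤ a`), the conjecture yields arbitrarily long
arithmetic progressions of primes (the Green–Tao theorem, the tree's
`Literature.NumberTheory.Sieve.exists_prime_arithmetic_progression`).
[cite: AletheiaZomleferFukshanskyGarcia2020, §7.5 Theorem 7.5.1] -/
def greenTao_of_batemanHorn : Prop :=
  BatemanHornConjecture → Sieve.exists_prime_arithmetic_progression

end Literature.NumberTheory.Sieve
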